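import Summits.ValiantsHypothesis.ValiantsHypothesis.Theses.UlrichPadded
import Literature.Computability.AlgebraicComplexity.PermanentIrreducible
import Literature.Computability.AlgebraicComplexity.VonZurGathenSingPermHeight
import Literature.RingTheory.MvPolynomial.KaltofenBoundsMatrixTools

/-!
# Crux `RankOneTrivialisation` (stmt-ValiantsHypothesis-5667, route `UlrichPadded`) —
line `pic-not-cl`, planner skeleton

Crux (the route's decl, concluded BY NAME below):
`UlrichPadded.RankOneTrivialisation :
  ∀ n ≥ 3, ∀ m, ∀ A : Matrix (Fin m) (Fin m) ℂ[x_{n×n}], IsAffineDetRepr per_n A →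
    ∃ c w dc dw, dc + dw ≤ m - 1 ∧ (deg cᵢ ≤ dc) ∧ (deg wⱼ ≤ dw) ∧ ∀ i j, adj A i j - cᵢ wⱼ ∈ (per_n)`.

The line (idea card `Cruxes/RankOneTrivialisation/Ideas/pic-not-cl.md`, triage r1 3 × pass):
the obstruction to the factorisation is the class of the kernel LINE BUNDLE of `A` in
`Pic(S_n)`, `S_n = ℂ[x]/(per_n)` — not a class in `Cl(S_n)` — and it vanishes.

1. `stub_adjugateUnitContent` — von zur Gathen's corank theorem (PROVED in tree, pointwise at
   every point of `ℂ^{n²}`) in ideal form: the submaximal minors of ANY polynomial matrix `A`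
   with `det A = per_n`, `n ≥ 3`, generate the unit ideal of `ℂ[x]`.  This is where `3 ≤ n` and
   `char ℂ ≠ 2` are consumed (Disproof `rankOneTrivialisation_false_without_three_le`: at
   `n = 2` the vertex of the quadric cone is a corank-2 point and the stub is false).
2. `stub_adjugate_twoByTwo_of_det_eq_zero` — linear algebra over a domain: `det B = 0 ⇒` all
   `2 × 2` minors of `adj B` vanish (rank `adj B ≤ 1`).  Applied to `Ā = A mod per_n` over the
   domain `S_n`: `adj Ā` is a RANK-ONE matrix.
3. `stub_unitContentRankOneFactors` — the transfer `C⁺ = "Pic(S_n) = 0"` in matrix form: over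
   `S_n` (`n ≥ 3`) every rank-one matrix whose entries generate the unit ideal is an outer
   product `c wᵀ` (its column module is an invertible `S_n`-module, hence free: `Pic` of the
   normal graded cone `S_n` is trivial — Fossum 1973 Cor. 18.3 + Cor. 10.3; or, since crux 5666
   is now CLOSED (`Summit.ValiantsHypothesis.Theorems.permQuot_isDomain_and_ufm`: `S_n` is a UFD
   for `n ≥ 3`), gcd-extraction of a non-zero column suffices).  HARDEST stub.
4. `stub_degreeBudget_mod_homogeneous_prime` — graded bookkeeping, generic: modulo a homogeneous
   prime form `f`, an outer-product factorisation `B ≡ c' w'ᵀ` of a matrix with `deg B_ij ≤ D`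
   can be re-chosen with `deg c + deg w ≤ D` (top components multiply in the graded domain
   `K[x]/(f)`; truncate lifts).  This is where affineness is consumed (`deg adj A ≤ m - 1`;
   Disproof `rankOneTrivialisation_false_without_affine`) and why the bound is exactly `m - 1`
   (tight at the twisted Grenet matrix `Bpp`, Disproof `rankOneTrivialisation_tight_at_Bpp`).

`RankOneTrivialisation_of` composes 1–4 (sorry-free body; the skeleton audit requires the
concluding theorem to take no hypotheses, so the stubs are used inside the proof).
-/

noncomputable section

set_option linter.dupNamespace false

namespace Summit.ValiantsHypothesis.ValiantsHypothesis.Cruxes.RankOneTrivialisation.PicNotCl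

open MvPolynomial Matrix Literature.Computability.AlgebraicComplexity

/-! ## The registered stubs -/

/-- **Stub 1 (K — von zur Gathen in ideal form: the kernel sheaf is a line bundle).** For
`n ≥ 3` and ANY square polynomial matrix `A` over `ℂ[x_{n×n}]` with `det A = per_n`, the signed
submaximal minors of `A` generate the unit ideal: `I_{m-1}(A) = ℂ[x]`.  Proof plan: if
`adjIdeal A ≠ ⊤`, Eagon–Northcott (`vonzurGathen1987_submaximalMinors_height_holds`) gives a
minimal prime over it of height `≤ 4`, which contains `singPermIdeal ℂ n`
(`singPermIdeal_le_adjIdeal`) and so has height `≥ 5` (`vonzurGathen1987_singPerm_height_holds`,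
needs `3 ≤ n`, `(2 : ℂ) ≠ 0`) — exactly the argument of `VonZurGathen.false_of_adjugate_eval_eq_zero`
without the evaluation point; sizes `m ≤ 1` by hand (`m = 0`: `det = 1 ≠ per_n`; `m = 1`: `adj = 1`).
False at `n = 2` (`A₂ = [[x₀₀, -x₀₁], [x₁₀, x₁₁]]`: `adjIdeal A₂ = (x) ≠ ⊤`). [cite: Vonzurgathen1987, Thm. 3.1] -/
theorem stub_adjugateUnitContent :
    ∀ n : ℕ, 3 ≤ n → ∀ (m : ℕ) (A : Matrix (Fin m) (Fin m) (MvPolynomial (Fin n × Fin n) ℂ)),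
      A.det = perPoly (Fin n) ℂ → VonZurGathen.adjIdeal A = ⊤ := by
  sorry

/-- **Stub 2 (rank one of the adjugate of a singular matrix, over a domain).** If `B` is a square
matrix over an integral domain with `det B = 0`, then all `2 × 2` minors of `adj B` vanish:
over the fraction field either `adj B = 0` or `rank B = m - 1`, `B · adj B = 0`, so every column
of `adj B` lies in the one-dimensional kernel of `B`.  (Jacobi's identity gives the same over any
commutative ring; the domain case is all the line needs, for `S_n = ℂ[x]/(per_n)`.) [folklore] -/
theorem stub_adjugate_twoByTwo_of_det_eq_zero :
    ∀ (S : Type) [CommRing S] [IsDomain S] (m : ℕ) (B : Matrix (Fin m) (Fin m) S), B.det = 0 →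
      ∀ i j k l : Fin m, B.adjugate i j * B.adjugate k l = B.adjugate i l * B.adjugate k j := by
  sorry

/-- **Stub 3 (the transfer C⁺: `Pic(ℂ[x]/(per_n)) = 0`, matrix form).** Over
`S_n = ℂ[x_{n×n}]/(per_n)`, `n ≥ 3`, every square matrix `B` whose `2 × 2` minors vanish and
whose entries generate the unit ideal is an outer product `B = c wᵀ`.  Why true: on the basic
open `D(B_ij)` the column module `N = Σ_l S_n · col_l(B) ⊆ S_n^m` is free on `col_j(B)`
(`col_l = (B_il / B_ij) col_j`), so `N` is an invertible `S_n`-module; `S_n` is a noetherian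
NORMAL ℕ-graded domain with `(S_n)₀ = ℂ` (normality = R1 from vzG's height bound + S2 for a
hypersurface), hence `Pic(S_n) ↪ Cl(S_n) ≅ Cl((S_n)_𝔪) ⊇ image of Pic((S_n)_𝔪) = 0`
(Fossum 1973 Cor. 18.3, Cor. 10.3, p. 35), so `N = S_n · c` and `col_l = w_l c`.  Second road
(crux 5666 is CLOSED, 2026-08-16: `Summit.ValiantsHypothesis.Theorems.permQuot_isDomain_and_ufm :
3 ≤ n → ∃ _ : IsDomain S_n, UniqueFactorizationMonoid S_n`, file
`Theorems/UlrichPaddedPermHypersurfaceFactorial.lean`): `S_n` is a UFD, so Mathlib's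
`Subsingleton (CommRing.Pic S_n)` is `inferInstance` (GCD domain) and, more cheaply, `c :=` the
primitive part of a non-zero column works by gcd extraction.  The statement is true for every `n`
(`Pic` of any normal cone over a field vanishes; `S₂` is normal with `Cl = ℤ`), the guard
`3 ≤ n` only keeps both in-tree roads available; `3 ≤ n` is load-bearing in stub 1, not here.
[cite: Fossum1973, Cor. 10.3] -/
theorem stub_unitContentRankOneFactors :
    ∀ n : ℕ, 3 ≤ n → ∀ (m : ℕ)
      (B : Matrix (Fin m) (Fin m) (MvPolynomial (Fin n × Fin n) ℂ ⧸ Ideal.span {perPoly (Fin n) ℂ})),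
      (∀ i j k l : Fin m, B i j * B k l = B i l * B k j) →
      Ideal.span (Set.range fun p : Fin m × Fin m => B p.1 p.2) = ⊤ →
        ∃ c w : Fin m → MvPolynomial (Fin n × Fin n) ℂ ⧸ Ideal.span {perPoly (Fin n) ℂ},
          ∀ i j : Fin m, B i j = c i * w j := by
  sorry

/-- **Stub 4 (the degree budget is automatic modulo a homogeneous prime form).** Let `f ∈ K[σ]`
be a prime form (homogeneous of some degree `e`), `B` an `m × m` matrix with all entries of
total degree `≤ D`, and suppose `B ≡ c' w'ᵀ (mod f)` entrywise for SOME vectors `c', w'`.  Then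
there are `c, w` and `dc + dw ≤ D` with `deg cᵢ ≤ dc`, `deg wⱼ ≤ dw` and still
`B ≡ c wᵀ (mod f)`.  Proof plan: `(f)` is a homogeneous prime, so for `p ∉ (f)` the reduced
degree `δ(p) = max {d : p_d ∉ (f)}` is additive on products; if `B ≡ 0` take `c = w = 0`;
otherwise put `dc = max δ(c'ᵢ)`, `dw = max δ(w'ⱼ)` over the entries `∉ (f)`, attained at
`i*, j*`, so `dc + dw = δ(c'_{i*} w'_{j*}) = δ(B_{i*j*}) ≤ D`, and replace each `c'ᵢ`, `w'ⱼ` by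
the truncation of its homogeneous components above `δ` (they lie in `(f)`), resp. by `0`.
Sharp: no better bound than `D` holds in general (Disproof: `Bpp`, `D = m - 1 = 6`). [folklore] -/
theorem stub_degreeBudget_mod_homogeneous_prime :
    ∀ (σ K : Type) [Field K] (f : MvPolynomial σ K) (e : ℕ), f.IsHomogeneous e → Prime f →
      ∀ (m D : ℕ) (B : Matrix (Fin m) (Fin m) (MvPolynomial σ K)),
        (∀ i j, (B i j).totalDegree ≤ D) →
        ∀ (c' w' : Fin m → MvPolynomial σ K), (∀ i j, B i j - c' i * w' j ∈ Ideal.span {f}) →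
          ∃ (c w : Fin m → MvPolynomial σ K) (dc dw : ℕ), dc + dw ≤ D ∧
            (∀ i, (c i).totalDegree ≤ dc) ∧ (∀ i, (w i).totalDegree ≤ dw) ∧
            ∀ i j, B i j - c i * w j ∈ Ideal.span {f} := by
  sorry

/-! ## The kernel-checked composition -/

/-- **The line closes the crux.** For an affine representation `A` of `per_n` (`n ≥ 3`):
stub 1 makes the submaximal minors of `A` generate `ℂ[x]`, hence the entries of
`B := adj A mod per_n` generate `S_n = ℂ[x]/(per_n)`; `S_n` is a domain (`per_n` irreducible)
and `det Ā = 0`, so stub 2 makes `B` rank one; stub 3 (`Pic(S_n) = 0`) factors `B = c̄ w̄ᵀ`;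
lifting `c̄, w̄` to polynomials gives `adj A ≡ c' w'ᵀ (mod per_n)`, and stub 4 (with
`deg adj A ≤ m - 1` for affine `A`, `totalDegree_adjugate_le`) re-chooses the factors within the
degree budget `m - 1`. [folklore] -/
theorem RankOneTrivialisation_of :
    Summit.ValiantsHypothesis.ValiantsHypothesis.Theses.UlrichPadded.RankOneTrivialisation := by
  intro n hn m A hA
  classical
  -- `S_n = ℂ[x]/(per_n)` is a domain
  haveI : Nonempty (Fin n) := ⟨⟨0, by omega⟩⟩
  have hp : Prime (perPoly (Fin n) ℂ) :=
    UniqueFactorizationMonoid.irreducible_iff_prime.mp perPoly_irreducible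
  haveI hIp : (Ideal.span {perPoly (Fin n) ℂ}).IsPrime :=
    (Ideal.span_singleton_prime hp.ne_zero).mpr hp
  haveI : IsDomain (MvPolynomial (Fin n × Fin n) ℂ ⧸ Ideal.span {perPoly (Fin n) ℂ}) :=
    Ideal.Quotient.isDomain _
  -- stub 1: the submaximal minors of `A` generate the unit ideal of `ℂ[x]`
  have hK : VonZurGathen.adjIdeal A = ⊤ := stub_adjugateUnitContent n hn m A hA.2
  -- the reduced adjugate `B = adj A mod per_n`
  let mk : MvPolynomial (Fin n × Fin n) ℂ →+*
      MvPolynomial (Fin n × Fin n) ℂ ⧸ Ideal.span {perPoly (Fin n) ℂ} :=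
    Ideal.Quotient.mk (Ideal.span {perPoly (Fin n) ℂ})
  let B : Matrix (Fin m) (Fin m) (MvPolynomial (Fin n × Fin n) ℂ ⧸ Ideal.span {perPoly (Fin n) ℂ}) :=
    A.adjugate.map mk
  have hBdef : ∀ i j, B i j = mk (A.adjugate i j) := fun i j => rfl
  -- stub 2: `B` has rank one (`det Ā = per_n mod per_n = 0` in the domain `S_n`)
  have hdet : (A.map mk).det = 0 := by
    show (mk.mapMatrix A).det = 0
    rw [← RingHom.map_det, hA.2]
    exact Ideal.Quotient.eq_zero_iff_mem.mpr (Ideal.mem_span_singleton_self _)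
  have hadjmap : (A.map mk).adjugate = B := by
    show (mk.mapMatrix A).adjugate = _
    rw [← RingHom.map_adjugate]
    rfl
  have hB1 : ∀ i j k l : Fin m, B i j * B k l = B i l * B k j := by
    intro i j k l
    have h := stub_adjugate_twoByTwo_of_det_eq_zero
      (MvPolynomial (Fin n × Fin n) ℂ ⧸ Ideal.span {perPoly (Fin n) ℂ}) m (A.map mk) hdet i j k l
    rwa [hadjmap] at h
  -- the entries of `B` generate the unit ideal of `S_n`
  have hB2 : Ideal.span (Set.range fun p : Fin m × Fin m => B p.1 p.2) = ⊤ := by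
    have h := congrArg (Ideal.map mk) hK
    rw [Ideal.map_top, VonZurGathen.adjIdeal, Ideal.map_span, ← Set.range_comp] at h
    exact h
  -- stub 3: `Pic(S_n) = 0` — `B` is an outer product over `S_n`
  obtain ⟨cb, wb, hcw⟩ := stub_unitContentRankOneFactors n hn m B hB1 hB2
  -- lift the factors to polynomials
  obtain ⟨c', hc'⟩ : ∃ c' : Fin m → MvPolynomial (Fin n × Fin n) ℂ, ∀ i, mk (c' i) = cb i :=
    ⟨fun i => (Ideal.Quotient.mk_surjective (cb i)).choose,
      fun i => (Ideal.Quotient.mk_surjective (cb i)).choose_spec⟩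
  obtain ⟨w', hw'⟩ : ∃ w' : Fin m → MvPolynomial (Fin n × Fin n) ℂ, ∀ j, mk (w' j) = wb j :=
    ⟨fun j => (Ideal.Quotient.mk_surjective (wb j)).choose,
      fun j => (Ideal.Quotient.mk_surjective (wb j)).choose_spec⟩
  have hfac : ∀ i j, A.adjugate i j - c' i * w' j ∈ Ideal.span {perPoly (Fin n) ℂ} := by
    intro i j
    rw [← Ideal.Quotient.eq]
    show mk (A.adjugate i j) = mk (c' i * w' j)
    rw [map_mul, hc', hw', ← hBdef]
    exact hcw i j
  -- stub 4: the degree budget `m - 1` is automatic for affine `A`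
  have hdeg : ∀ i j, (A.adjugate i j).totalDegree ≤ m - 1 := by
    intro i j
    have h := Literature.RingTheory.MvPolynomial.KaltofenBounds.totalDegree_adjugate_le A 1 hA.1 i j
    rwa [Fintype.card_fin, mul_one] at h
  exact stub_degreeBudget_mod_homogeneous_prime (Fin n × Fin n) ℂ (perPoly (Fin n) ℂ)
    (Fintype.card (Fin n)) (perPoly_isHomogeneous (n := Fin n) (k := ℂ)) hp m (m - 1) A.adjugate
    hdeg c' w' hfac

end Summit.ValiantsHypothesis.ValiantsHypothesis.Cruxes.RankOneTrivialisation.PicNotCl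

end
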